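import Mathlib
import HarnessLib
import Summits.ABC.ABC.Theses.CongruentialReceptacle

/-!
# `CompactBalanceTransfer` (stmt-ABC-1725), line `Sketch` — the RESIDUE-FREE cusp-weighted receptacle is false

Negative support for crux stmt-ABC-1725 (`Summit.ABC.ABC.Theses.CongruentialReceptacle.CompactBalanceTransfer`),
written by the line lead (`prover-line-stmt-ABC-1725-0`, 2026-08-16). The picked line `Sketch` (card
`cusp-weighted-receptacle`, `Cruxes/CompactBalanceTransfer/Lines/Sketch.lean`) has exactly one stub,
`CuspWeightedReceptacle`: for every `ε > 0`, constants `c₁ > 0, c₁′, c₃, m₀` such that for every prime power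
`ℓⁿ ≥ m₀` (`ℓ ≥ 5`) there is an INTEGER table `t(p; v_p a, v_p b, v_p c; a′, b′, c′ mod p)` with lower window
`c₁ (v_p c − 1 − ε) log p ≤ t`, upper window `|t| ≤ c₁′ (v_p a + v_p b + v_p c + 1) log p`, and
`Σ_{p ∣ abc} t ≡ B (mod ℓⁿ)`, `|B| ≤ c₃`, on every abc-triple prime to `ℓ`.

This file proves that its RESIDUE-FREE strengthening — the same statement for tables `t(p; v_p a, v_p b, v_p c)`
that do not look at the unit residues — is false, for EVERY real `ε` and all constants
(`cuspWeighted_residueFree_false`), hence `not_cuspWeightedReceptacle_residueFree`. The card's cheapest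
falsifier predicted this via an Elliott-type rigidity argument; the certificate here is three triples:

* `(1, 2ᵏ − 1, 2ᵏ)`     : `t(2;0,0,k) + Σ_{q ∣ 2ᵏ−1} t(q;0,v_q,0) = B₃`,
* `(2, 2ᵏ − 1, 2ᵏ + 1)` : `t(2;1,0,0) + Σ_{q ∣ 2ᵏ−1} t(q;0,v_q,0) + Σ_{p ∣ 2ᵏ+1} t(p;0,0,v_p) = B₂`,
* `(1, 2ᵏ, 2ᵏ + 1)`     : `t(2;0,k,0) + Σ_{p ∣ 2ᵏ+1} t(p;0,0,v_p) = B₁`,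

read at ONE prime modulus `ℓ` exceeding `m₀`, the three products `abc` and the a-priori window bound, so that
each congruence is an identity in `ℤ` with `|Bᵢ| ≤ c₃`. Eliminating the two shared sums,
`t(2;0,k,0) = B₁ − B₂ + B₃ + t(2;1,0,0) − t(2;0,0,k) ≤ 3c₃ + 2c₁′ log 2 − c₁ (k − 1 − ε) log 2`, against the lower
window `t(2;0,k,0) ≥ −c₁ (1 + ε) log 2`: false once `k > (3c₃ + 2c₁′ log 2)/(c₁ log 2) + 2 + 2ε`.

What this does NOT refute: the residue-dependent stub itself. At every odd prime `p ∣ bc` the residues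
`a mod p ∈ {1, 2}` separate the table entries of the three triples, so the shared sums no longer cancel; with
residues the stub implies `ABC` (`Lines/Sketch.lean: abc_of_cuspWeightedReceptacle`) and its kill test coincides
with the sibling crux stmt-ABC-14354 (`TameLocalReceptacle`).
-/

-- `Summit.<Summit>.<Problem>`: for the single-conjunct summit `ABC` the duplicate `ABC.ABC` is mandated.
set_option linter.dupNamespace false

namespace Summit.ABC.ABC.Theorems.CompactBalanceTransfer.Negative

open Literature.NumberTheory.DiophantineGeometry

/-- Congruence to equality with real a-priori bounds: integers congruent modulo `m` whose absolute values
have real bounds `X`, `Y` with `X + Y < m` are equal. [folklore] -/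
theorem eq_of_modEq_of_abs_le {m : ℕ} {x y : ℤ} (h : x ≡ y [ZMOD (m : ℤ)]) {X Y : ℝ}
    (hx : |(x : ℝ)| ≤ X) (hy : |(y : ℝ)| ≤ Y) (hm : X + Y < (m : ℝ)) : x = y := by
  have hd : (m : ℤ) ∣ y - x := h.dvd
  have hx' := abs_le.mp hx
  have hy' := abs_le.mp hy
  have habs : |((y - x : ℤ) : ℝ)| < (m : ℝ) := by
    push_cast
    rw [abs_lt]
    constructor <;> linarith
  have habs' : |y - x| < (m : ℤ) := by exact_mod_cast habs
  have h0 := Int.eq_zero_of_abs_lt_dvd hd habs'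
  omega

/-- **The residue-free cusp-weighted receptacle is false, for every `ε` and all constants.** If for every
prime `ℓ ≥ 5` and `n` with `ℓⁿ ≥ m₀` there were an integer table `t(p; i, j, k)` on (prime, `v_p a`, `v_p b`,
`v_p c`) with `c₁ (k − 1 − ε) log p ≤ t ≤ …`, `|t| ≤ c₁′ (i + j + k + 1) log p` and
`Σ_{p ∣ abc} t(p; v_p a, v_p b, v_p c) ≡ B (mod ℓⁿ)`, `|B| ≤ c₃`, for all abc-triples prime to `ℓ`, then the
triples `(1, 2ᵏ−1, 2ᵏ)`, `(2, 2ᵏ−1, 2ᵏ+1)`, `(1, 2ᵏ, 2ᵏ+1)` at a single large prime modulus force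
`c₁ (k − 2 − 2ε) log 2 ≤ 3c₃ + 2·max(c₁′,0)·log 2`, which fails for large `k`. [folklore] -/
theorem cuspWeighted_residueFree_false (ε c₁ c₁' c₃ : ℝ) (hc₁ : 0 < c₁) (m₀ : ℕ)
    (H : ∀ ℓ n : ℕ, ℓ.Prime → 5 ≤ ℓ → m₀ ≤ ℓ ^ n →
      ∃ t : ℕ → ℕ → ℕ → ℕ → ℤ,
        (∀ p i j k : ℕ, p.Prime →
          c₁ * (((k : ℕ) : ℝ) - 1 - ε) * Real.log p ≤ (t p i j k : ℝ) ∧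
          |(t p i j k : ℝ)| ≤ c₁' * (((i + j + k : ℕ) : ℝ) + 1) * Real.log p) ∧
        ∀ a b c : ℕ, IsABCTriple a b c → ¬ ℓ ∣ a * b * c →
          ∃ B : ℤ, |(B : ℝ)| ≤ c₃ ∧
            (∑ p ∈ (a * b * c).primeFactors,
                t p (a.factorization p) (b.factorization p) (c.factorization p)) ≡ B [ZMOD ((ℓ ^ n : ℕ) : ℤ)]) :
    False := by
  have hlog2 : (0 : ℝ) < Real.log 2 := Real.log_pos (by norm_num)
  -- a nonnegative majorant of the upper-window constant
  set K : ℝ := max c₁' 0 with hK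
  have hK0 : 0 ≤ K := le_max_right _ _
  have hK1 : c₁' ≤ K := le_max_left _ _
  -- the exponent k
  set A : ℝ := (3 * c₃ + 2 * K * Real.log 2) / (c₁ * Real.log 2) + 2 + 2 * ε with hA
  set k : ℕ := ⌈A⌉₊ + 1 with hk
  have hk1 : 1 ≤ k := by omega
  have hkA : A < (k : ℝ) := by
    rw [hk]; push_cast; linarith [Nat.le_ceil A]
  -- the numbers N = 2^k, M = N - 1, P = N + 1
  set N : ℕ := 2 ^ k with hN
  have hN2 : 2 ≤ N := by
    rw [hN]
    calc (2 : ℕ) = 2 ^ 1 := by norm_num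
      _ ≤ 2 ^ k := Nat.pow_le_pow_right (by norm_num) hk1
  set M : ℕ := N - 1 with hM
  set P : ℕ := N + 1 with hP
  have hMN : 1 + M = N := by omega
  have hM0 : 0 < M := by omega
  have hN0 : 0 < N := by omega
  have hP0 : 0 < P := by omega
  have hNeven : N % 2 = 0 := by
    have : Even N := by rw [hN]; exact (Nat.even_pow).mpr ⟨even_two, by omega⟩
    exact Nat.even_iff.mp this
  have h2M : ¬ 2 ∣ M := by omega
  have h2P : ¬ 2 ∣ P := by omega
  have hcop2M : Nat.Coprime 2 M := (Nat.Prime.coprime_iff_not_dvd Nat.prime_two).mpr h2M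
  have hcopMP : Nat.Coprime M P := by
    have hPM : P = M + 2 := by omega
    rw [hPM, Nat.coprime_self_add_right]
    exact hcop2M.symm
  -- factorisation bookkeeping
  have hNf2 : N.factorization 2 = k := by
    rw [hN, Nat.Prime.factorization_pow Nat.prime_two, Finsupp.single_eq_same]
  have hNf : ∀ p : ℕ, p.Prime → p ≠ 2 → N.factorization p = 0 := by
    intro p hp hp2
    refine Nat.factorization_eq_zero_of_not_dvd fun h => hp2 ?_
    rw [hN] at h
    exact (Nat.prime_dvd_prime_iff_eq hp Nat.prime_two).mp (hp.dvd_of_dvd_pow h)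
  have h2f2 : (2 : ℕ).factorization 2 = 1 := Nat.Prime.factorization_self Nat.prime_two
  have h2f : ∀ p : ℕ, p.Prime → p ≠ 2 → (2 : ℕ).factorization p = 0 := by
    intro p hp hp2
    exact Nat.factorization_eq_zero_of_not_dvd fun h =>
      hp2 ((Nat.prime_dvd_prime_iff_eq hp Nat.prime_two).mp h)
  have hMf2 : M.factorization 2 = 0 := Nat.factorization_eq_zero_of_not_dvd h2M
  have hPf2 : P.factorization 2 = 0 := Nat.factorization_eq_zero_of_not_dvd h2P
  have h1f : ∀ p : ℕ, (1 : ℕ).factorization p = 0 := by intro p; simp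
  have hPfM : ∀ p ∈ M.primeFactors, P.factorization p = 0 := by
    intro p hp
    have pp := Nat.prime_of_mem_primeFactors hp
    refine Nat.factorization_eq_zero_of_not_dvd fun h => ?_
    have hg : p ∣ Nat.gcd M P := Nat.dvd_gcd (Nat.dvd_of_mem_primeFactors hp) h
    rw [hcopMP.gcd_eq_one] at hg
    exact pp.one_lt.ne' (Nat.dvd_one.mp hg)
  have hMfP : ∀ p ∈ P.primeFactors, M.factorization p = 0 := by
    intro p hp
    have pp := Nat.prime_of_mem_primeFactors hp
    refine Nat.factorization_eq_zero_of_not_dvd fun h => ?_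
    have hg : p ∣ Nat.gcd M P := Nat.dvd_gcd h (Nat.dvd_of_mem_primeFactors hp)
    rw [hcopMP.gcd_eq_one] at hg
    exact pp.one_lt.ne' (Nat.dvd_one.mp hg)
  have hpM2 : ∀ p ∈ M.primeFactors, p ≠ 2 := fun p hp h => h2M (h ▸ Nat.dvd_of_mem_primeFactors hp)
  have hpP2 : ∀ p ∈ P.primeFactors, p ≠ 2 := fun p hp h => h2P (h ▸ Nat.dvd_of_mem_primeFactors hp)
  -- prime supports of the three products
  have hNpf : N.primeFactors = {2} := by
    rw [hN]; exact Nat.primeFactors_prime_pow (by omega) Nat.prime_two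
  have h2pf : (2 : ℕ).primeFactors = {2} := Nat.Prime.primeFactors Nat.prime_two
  have h2nM : (2 : ℕ) ∉ M.primeFactors := fun h => h2M (Nat.dvd_of_mem_primeFactors h)
  have h2nP : (2 : ℕ) ∉ P.primeFactors := fun h => h2P (Nat.dvd_of_mem_primeFactors h)
  have hdM2 : Disjoint M.primeFactors ({2} : Finset ℕ) := Finset.disjoint_singleton_right.mpr h2nM
  have hd2M : Disjoint ({2} : Finset ℕ) M.primeFactors := Finset.disjoint_singleton_left.mpr h2nM
  have hd2P : Disjoint ({2} : Finset ℕ) P.primeFactors := Finset.disjoint_singleton_left.mpr h2nP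
  have hdMP : Disjoint M.primeFactors P.primeFactors := hcopMP.disjoint_primeFactors
  have hpf3 : (1 * M * N).primeFactors = M.primeFactors ∪ {2} := by
    rw [one_mul, Nat.primeFactors_mul hM0.ne' hN0.ne', hNpf]
  have hpf2 : (2 * M * P).primeFactors = ({2} ∪ M.primeFactors) ∪ P.primeFactors := by
    rw [Nat.primeFactors_mul (Nat.mul_pos two_pos hM0).ne' hP0.ne', Nat.primeFactors_mul two_ne_zero hM0.ne',
      h2pf]
  have hpf1 : (1 * N * P).primeFactors = {2} ∪ P.primeFactors := by
    rw [one_mul, Nat.primeFactors_mul hN0.ne' hP0.ne', hNpf]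
  -- a-priori (table-independent) window bounds
  have hlogp : ∀ p : ℕ, 0 ≤ Real.log p := fun p => Real.log_natCast_nonneg p
  set ZM : ℝ := ∑ p ∈ M.primeFactors, K * (((M.factorization p : ℕ) : ℝ) + 1) * Real.log p with hZM
  set ZP : ℝ := ∑ p ∈ P.primeFactors, K * (((P.factorization p : ℕ) : ℝ) + 1) * Real.log p with hZP
  set Z2 : ℝ := K * (((k : ℕ) : ℝ) + 1) * Real.log 2 with hZ2
  set Zbig : ℝ := 2 * Z2 + ZM + ZP with hZbig
  have hZM0 : 0 ≤ ZM :=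
    Finset.sum_nonneg fun p _ => mul_nonneg (mul_nonneg hK0 (by positivity)) (hlogp p)
  have hZP0 : 0 ≤ ZP :=
    Finset.sum_nonneg fun p _ => mul_nonneg (mul_nonneg hK0 (by positivity)) (hlogp p)
  have hZ20 : 0 ≤ Z2 := mul_nonneg (mul_nonneg hK0 (by positivity)) hlog2.le
  -- the modulus: ONE prime ℓ above everything, exponent n = 1
  set X : ℕ := 2 * M * N * P with hX
  obtain ⟨ℓ, hℓge, hℓp⟩ := Nat.exists_infinite_primes (X + m₀ + 5 + ⌈Zbig + c₃⌉₊ + 1)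
  have h5 : 5 ≤ ℓ := by omega
  have hm₀ : m₀ ≤ ℓ ^ 1 := by rw [pow_one]; omega
  have hℓR : Zbig + c₃ < ((ℓ ^ 1 : ℕ) : ℝ) := by
    have h1 : ((⌈Zbig + c₃⌉₊ : ℕ) : ℝ) + 1 ≤ (ℓ : ℝ) := by
      exact_mod_cast (show ⌈Zbig + c₃⌉₊ + 1 ≤ ℓ by omega)
    rw [pow_one]
    linarith [Nat.le_ceil (Zbig + c₃)]
  have hX3 : 1 * M * N ≤ X := by
    rw [hX]
    calc 1 * M * N = M * N * 1 := by ring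
      _ ≤ M * N * (2 * P) := Nat.mul_le_mul_left _ (by omega)
      _ = 2 * M * N * P := by ring
  have hX2 : 2 * M * P ≤ X := by
    rw [hX]
    calc 2 * M * P = 2 * M * P * 1 := by ring
      _ ≤ 2 * M * P * N := Nat.mul_le_mul_left _ (by omega)
      _ = 2 * M * N * P := by ring
  have hX1 : 1 * N * P ≤ X := by
    rw [hX]
    calc 1 * N * P = N * P * 1 := by ring
      _ ≤ N * P * (2 * M) := Nat.mul_le_mul_left _ (by omega)
      _ = 2 * M * N * P := by ring
  have hnd3 : ¬ ℓ ∣ 1 * M * N :=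
    Nat.not_dvd_of_pos_of_lt (Nat.mul_pos (Nat.mul_pos one_pos hM0) hN0) (by omega)
  have hnd2 : ¬ ℓ ∣ 2 * M * P :=
    Nat.not_dvd_of_pos_of_lt (Nat.mul_pos (Nat.mul_pos two_pos hM0) hP0) (by omega)
  have hnd1 : ¬ ℓ ∣ 1 * N * P :=
    Nat.not_dvd_of_pos_of_lt (Nat.mul_pos (Nat.mul_pos one_pos hN0) hP0) (by omega)
  -- the table at modulus ℓ and the three triples
  obtain ⟨t, ht, hT⟩ := H ℓ 1 hℓp h5 hm₀
  obtain ⟨B₃, hB₃, hc₃⟩ := hT 1 M N ⟨one_pos, hM0, hMN, Nat.coprime_one_left M⟩ hnd3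
  obtain ⟨B₂, hB₂, hc₂⟩ := hT 2 M P ⟨two_pos, hM0, by omega, hcop2M⟩ hnd2
  obtain ⟨B₁, hB₁, hc₁'⟩ := hT 1 N P ⟨one_pos, hN0, by omega, Nat.coprime_one_left N⟩ hnd1
  -- the windows at the prime 2, with the cast `((2 : ℕ) : ℝ) = 2` normalised
  have e2 : ((2 : ℕ) : ℝ) = 2 := by norm_num
  have ht2 : ∀ i j k' : ℕ, c₁ * (((k' : ℕ) : ℝ) - 1 - ε) * Real.log 2 ≤ (t 2 i j k' : ℝ) ∧
      |(t 2 i j k' : ℝ)| ≤ c₁' * (((i + j + k' : ℕ) : ℝ) + 1) * Real.log 2 := by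
    intro i j k'
    have h := ht 2 i j k' Nat.prime_two
    rwa [e2] at h
  -- the two shared sums
  set SM : ℤ := ∑ p ∈ M.primeFactors, t p 0 (M.factorization p) 0 with hSM
  set SP : ℤ := ∑ p ∈ P.primeFactors, t p 0 0 (P.factorization p) with hSP
  -- decompositions of the three triple sums
  have hSM3 : ∑ p ∈ M.primeFactors, t p ((1 : ℕ).factorization p) (M.factorization p) (N.factorization p)
      = SM := Finset.sum_congr rfl fun p hp => by
    rw [h1f p, hNf p (Nat.prime_of_mem_primeFactors hp) (hpM2 p hp)]
  have hSM2 : ∑ p ∈ M.primeFactors, t p ((2 : ℕ).factorization p) (M.factorization p) (P.factorization p)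
      = SM := Finset.sum_congr rfl fun p hp => by
    rw [h2f p (Nat.prime_of_mem_primeFactors hp) (hpM2 p hp), hPfM p hp]
  have hSP2 : ∑ p ∈ P.primeFactors, t p ((2 : ℕ).factorization p) (M.factorization p) (P.factorization p)
      = SP := Finset.sum_congr rfl fun p hp => by
    rw [h2f p (Nat.prime_of_mem_primeFactors hp) (hpP2 p hp), hMfP p hp]
  have hSP1 : ∑ p ∈ P.primeFactors, t p ((1 : ℕ).factorization p) (N.factorization p) (P.factorization p)
      = SP := Finset.sum_congr rfl fun p hp => by
    rw [h1f p, hNf p (Nat.prime_of_mem_primeFactors hp) (hpP2 p hp)]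
  have hS3 : ∑ p ∈ (1 * M * N).primeFactors,
      t p ((1 : ℕ).factorization p) (M.factorization p) (N.factorization p) = SM + t 2 0 0 k := by
    rw [hpf3, Finset.sum_union hdM2, Finset.sum_singleton, hSM3, h1f 2, hMf2, hNf2]
  have hS2 : ∑ p ∈ (2 * M * P).primeFactors,
      t p ((2 : ℕ).factorization p) (M.factorization p) (P.factorization p) = t 2 1 0 0 + SM + SP := by
    rw [hpf2, Finset.sum_union (Finset.disjoint_union_left.mpr ⟨hd2P, hdMP⟩), Finset.sum_union hd2M,
      Finset.sum_singleton, hSM2, hSP2, h2f2, hMf2, hPf2]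
  have hS1 : ∑ p ∈ (1 * N * P).primeFactors,
      t p ((1 : ℕ).factorization p) (N.factorization p) (P.factorization p) = t 2 0 k 0 + SP := by
    rw [hpf1, Finset.sum_union hd2P, Finset.sum_singleton, hSP1, h1f 2, hNf2, hPf2]
  rw [hS3] at hc₃
  rw [hS2] at hc₂
  rw [hS1] at hc₁'
  -- window bounds on the pieces
  have hSMabs : |((SM : ℤ) : ℝ)| ≤ ZM := by
    rw [hSM]
    push_cast
    rw [hZM]
    refine (Finset.abs_sum_le_sum_abs _ _).trans (Finset.sum_le_sum fun p hp => ?_)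
    have h := (ht p 0 (M.factorization p) 0 (Nat.prime_of_mem_primeFactors hp)).2
    refine h.trans ?_
    simp only [zero_add, add_zero]
    exact mul_le_mul_of_nonneg_right (mul_le_mul_of_nonneg_right hK1 (by positivity)) (hlogp p)
  have hSPabs : |((SP : ℤ) : ℝ)| ≤ ZP := by
    rw [hSP]
    push_cast
    rw [hZP]
    refine (Finset.abs_sum_le_sum_abs _ _).trans (Finset.sum_le_sum fun p hp => ?_)
    have h := (ht p 0 0 (P.factorization p) (Nat.prime_of_mem_primeFactors hp)).2
    refine h.trans ?_
    simp only [zero_add]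
    exact mul_le_mul_of_nonneg_right (mul_le_mul_of_nonneg_right hK1 (by positivity)) (hlogp p)
  have hγabs : |((t 2 0 0 k : ℤ) : ℝ)| ≤ Z2 := by
    have h := (ht2 0 0 k).2
    rw [hZ2]
    refine h.trans ?_
    simp only [zero_add]
    exact mul_le_mul_of_nonneg_right (mul_le_mul_of_nonneg_right hK1 (by positivity)) hlog2.le
  have hβabs : |((t 2 0 k 0 : ℤ) : ℝ)| ≤ Z2 := by
    have h := (ht2 0 k 0).2
    rw [hZ2]
    refine h.trans ?_
    simp only [zero_add, add_zero]
    exact mul_le_mul_of_nonneg_right (mul_le_mul_of_nonneg_right hK1 (by positivity)) hlog2.le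
  have hαabs : |((t 2 1 0 0 : ℤ) : ℝ)| ≤ 2 * K * Real.log 2 := by
    have h := (ht2 1 0 0).2
    have e : (((1 + 0 + 0 : ℕ) : ℝ) + 1) = 2 := by norm_num
    rw [e] at h
    have h3 : c₁' * 2 * Real.log 2 ≤ K * 2 * Real.log 2 :=
      mul_le_mul_of_nonneg_right (mul_le_mul_of_nonneg_right hK1 (by norm_num)) hlog2.le
    linarith
  have hαZ : 2 * K * Real.log 2 ≤ 2 * Z2 := by
    have hk0 : (0 : ℝ) ≤ ((k : ℕ) : ℝ) := Nat.cast_nonneg k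
    have h1 : K * Real.log 2 * 1 ≤ K * Real.log 2 * (((k : ℕ) : ℝ) + 1) :=
      mul_le_mul_of_nonneg_left (by linarith) (mul_nonneg hK0 hlog2.le)
    rw [hZ2]
    linarith
  -- congruence to equality for the three sums
  have hE3 : SM + t 2 0 0 k = B₃ := by
    refine eq_of_modEq_of_abs_le hc₃ (X := Zbig) (Y := c₃) ?_ hB₃ hℓR
    have hx := abs_le.mp hγabs
    have hy := abs_le.mp hSMabs
    push_cast
    rw [abs_le]
    constructor <;> linarith [hx.1, hx.2, hy.1, hy.2]
  have hE2 : t 2 1 0 0 + SM + SP = B₂ := by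
    refine eq_of_modEq_of_abs_le hc₂ (X := Zbig) (Y := c₃) ?_ hB₂ hℓR
    have hx := abs_le.mp hαabs
    have hy := abs_le.mp hSMabs
    have hz := abs_le.mp hSPabs
    push_cast
    rw [abs_le]
    constructor <;> linarith [hx.1, hx.2, hy.1, hy.2, hz.1, hz.2]
  have hE1 : t 2 0 k 0 + SP = B₁ := by
    refine eq_of_modEq_of_abs_le hc₁' (X := Zbig) (Y := c₃) ?_ hB₁ hℓR
    have hx := abs_le.mp hβabs
    have hz := abs_le.mp hSPabs
    push_cast
    rw [abs_le]
    constructor <;> linarith [hx.1, hx.2, hz.1, hz.2]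
  -- elimination: t(2;0,k,0) = B₁ - B₂ + B₃ + t(2;1,0,0) - t(2;0,0,k)
  have hElimZ : t 2 0 k 0 = B₁ - B₂ + B₃ + t 2 1 0 0 - t 2 0 0 k := by
    linear_combination hE1 - hE2 + hE3
  have hElim : ((t 2 0 k 0 : ℤ) : ℝ) = B₁ - B₂ + B₃ + t 2 1 0 0 - t 2 0 0 k := by
    exact_mod_cast hElimZ
  -- windows at the prime 2: lower bounds for t(2;0,0,k) and t(2;0,k,0)
  have hγlow : c₁ * (((k : ℕ) : ℝ) - 1 - ε) * Real.log 2 ≤ ((t 2 0 0 k : ℤ) : ℝ) := (ht2 0 0 k).1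
  have hβlow : c₁ * (((0 : ℕ) : ℝ) - 1 - ε) * Real.log 2 ≤ ((t 2 0 k 0 : ℤ) : ℝ) := (ht2 0 k 0).1
  simp only [Nat.cast_zero, zero_sub] at hβlow
  have hB₁' := (abs_le.mp hB₁).2
  have hB₂' := (abs_le.mp hB₂).1
  have hB₃' := (abs_le.mp hB₃).2
  have hα' := (abs_le.mp hαabs).2
  -- the inequality c₁ log 2 · (k − 2 − 2ε) ≤ 3c₃ + 2K log 2, contradicting the choice of k
  have key : c₁ * Real.log 2 * (((k : ℕ) : ℝ) - 2 - 2 * ε) ≤ 3 * c₃ + 2 * K * Real.log 2 := by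
    linarith [hγlow, hβlow, hElim, hB₁', hB₂', hB₃', hα']
  have hck : 0 < c₁ * Real.log 2 := mul_pos hc₁ hlog2
  have key' : ((k : ℕ) : ℝ) - 2 - 2 * ε ≤ (3 * c₃ + 2 * K * Real.log 2) / (c₁ * Real.log 2) := by
    rw [le_div_iff₀ hck]; linarith [key]
  have hAk : ((k : ℕ) : ℝ) ≤ A := by rw [hA]; linarith [key']
  linarith [hkA, hAk]

/-- **No residue-free cusp-weighted receptacle** (the residue-free strengthening of the stub of line
`Sketch` for crux stmt-ABC-1725 is false): it is NOT the case that for every `ε > 0` there are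
`c₁ > 0, c₁′, c₃, m₀` and, for every prime `ℓ ≥ 5` and `n` with `ℓⁿ ≥ m₀`, an integer table
`t(p; v_p a, v_p b, v_p c)` with the cusp-weighted windows whose sum over `p ∣ abc` is `≡ B (mod ℓⁿ)`,
`|B| ≤ c₃`, on all abc-triples prime to `ℓ`. Any witness of `CuspWeightedReceptacle` must therefore use the
unit residues `a′, b′, c′ mod p`. [folklore] -/
theorem not_cuspWeightedReceptacle_residueFree :
    ¬ (∀ ε : ℝ, 0 < ε → ∃ c₁ c₁' c₃ : ℝ, 0 < c₁ ∧ ∃ m₀ : ℕ, ∀ ℓ n : ℕ, ℓ.Prime → 5 ≤ ℓ → m₀ ≤ ℓ ^ n →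
      ∃ t : ℕ → ℕ → ℕ → ℕ → ℤ,
        (∀ p i j k : ℕ, p.Prime →
          c₁ * (((k : ℕ) : ℝ) - 1 - ε) * Real.log p ≤ (t p i j k : ℝ) ∧
          |(t p i j k : ℝ)| ≤ c₁' * (((i + j + k : ℕ) : ℝ) + 1) * Real.log p) ∧
        ∀ a b c : ℕ, IsABCTriple a b c → ¬ ℓ ∣ a * b * c →
          ∃ B : ℤ, |(B : ℝ)| ≤ c₃ ∧
            (∑ p ∈ (a * b * c).primeFactors,
                t p (a.factorization p) (b.factorization p) (c.factorization p)) ≡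
              B [ZMOD ((ℓ ^ n : ℕ) : ℤ)]) := by
  intro h
  obtain ⟨c₁, c₁', c₃, hc₁, m₀, H⟩ := h 1 one_pos
  exact cuspWeighted_residueFree_false 1 c₁ c₁' c₃ hc₁ m₀ H

end Summit.ABC.ABC.Theorems.CompactBalanceTransfer.Negative
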